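import Summits.Ventures.WeilGRH.TwistedTailOddJ
import Summits.Ventures.WeilGRH.TwistedDataRung
import HarnessLib

/-!
# GRH arm (rh-explicit, venture WeilGRH): twisted format C, the DATA-ONLY front door at tail order `J` — two kernel PSD
  checks + numeric inequalities ⟹ `WeilPositivityOnChar χ a` for a REAL character χ (either parity)

Cell `rh-explicit`, WEIL TRACK — GRH ARM (lit/typing seat weil-grh-5 gen11).  Twisted copy of weil-10's
`WeilFormatC.weilPositivityOn_of_formatC_dataJ` (`WeilFormatCDataRungJ.lean`, FORMATC-DESIGN §9.9): the order-`J` version of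
`weilPositivityOnChar_of_twisted_formatC_data` (`TwistedDataRung.lean`).  Ingredients: weil-grh-1's door
`TwistedGramAnyParity.weilPositivityOnChar_of_twistedGramCoeff_sector_psd_real` (sections of the real kernel
`twistedGramCoeff χ a` PSD in both SectorSplit sectors ⟹ test positivity, real χ of either parity), weil-10's ∀N Schur
soundness `WeilFormatC.sum_range_mul_mul_nonneg_of_certificate_sum_split`, the twisted L-C3a
`twistedGramCoeff_even_far_ge_diag` / `twistedGramCoeff_odd_far_ge_diag_atan` (`TwistedFarAssembly.lean`), exact columns on
`[B, B₃)` (`WeilFormatC.columns_majorant`) and the ORDER-`J` Hankel tails of this generation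
(`even/odd_twisted_tailJ_majorant`, `TwistedTailEvenJ/OddJ.lean`), here first put in MATRIX form:

* `even_twisted_tailJ_majorant_matrix`, `odd_twisted_tailJ_majorant_matrix` — the right sides of
  `even/odd_twisted_tailJ_majorant` as `xᵀU₂^±x` for explicit `B × B` matrices (`hU₂` shape of the soundness theorem);
* `weilPositivityOnChar_of_twisted_formatC_dataJ` — `q ≠ 1`, `conj χ = χ`, `a > 0`; EVEN: block `B⁺ ≥ 2`, columns
  `2B⁺ ≤ B₃⁺`, order `Je`, Peter–Paul `θe, ηe > 0`, the numeric facts `0 < d̂⁺_χ(B⁺)`, `0 < d₀⁺ ≤ d̂⁺_χ(B₃⁺)`, weights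
  `0 < w⁺_m ≤ d̂⁺_χ(m)` on `[B⁺, B₃⁺)`, and the kernel certificate `∀ x, 0 ≤ Σ x_i x_j (M⁺_χ(i,j) − Σ_m M⁺_χ(i,m)M⁺_χ(j,m)/w⁺_m
  − U₂⁺(i,j))` with the explicit order-`Je` tail matrix; ODD: the same with `B⁻ ≥ 1`, `d̂⁻_χ` (arctan), `U₂⁻`, order `Jo`.
  Conclusion: `WeilPositivityOnChar χ a`.

Versus ζ (`weilPositivityOn_of_formatC_dataJ`): no polar families in `U₂^±`, no pole penalty in `d̂⁻`, `+(log q)/2` in both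
far diagonals, prime data re-weighted by `Re χ(k)`.  Versus order 1 (`TwistedDataRung.lean`): the exact-column range can stop
at `B₃ = 2B` (remainder `∝ 4^{−J}`) — the regime of the thin-margin small-conductor cells.  Every remaining premise is a
finite inequality between explicit reals or a PSD check (weil-2 evaluator + `PsdDyadic` scope).  Standard axioms; no
definitions; no named facts; no GRH claim.
-/

set_option autoImplicit false

noncomputable section

open Complex Finset Matrix
open scoped Real BigOperators ComplexConjugate ArithmeticFunction.vonMangoldt

namespace Summit.Ventures.WeilGRH

open Literature.NumberTheory.LFunctions
open Literature.NumberTheory.LFunctions.Yoshida1992 (freq incrCoeff archCoeff archExpSumSin)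
open Literature.Analysis.SpecialFunctions
open Summit.RiemannHypothesis.RiemannHypothesis.Theorems.WeilFormatC

variable {q : ℕ} {a : ℝ}

/-! ## The order-`J` tail majorants as explicit matrices -/

section MatrixForm

/-- **Even tail majorant for a character, order `J` — matrix form** (`hU₂` of
`sum_range_mul_mul_nonneg_of_certificate_sum_split`, even sector). -/
theorem even_twisted_tailJ_majorant_matrix (χ : DirichletCharacter ℂ q) (ha : 0 < a) {B B₃ : ℕ} (hB : 1 ≤ B) (hBB : 2 * B ≤ B₃) (hB₃ : 2 ≤ B₃) (J : ℕ)
    (d : ℕ → ℝ) {d₀ : ℝ} (hd₀ : 0 < d₀) (hd : ∀ m, B₃ ≤ m → d₀ ≤ d m) {θ η : ℝ} (hθ : 0 < θ) (hη : 0 < η)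
    (N : ℕ) (x : Fin B → ℝ) :
    ∑ m ∈ Finset.Ico B₃ N, (∑ i : Fin B,
        (if (i : ℕ) = 0 then twistedGramCoeff χ a 0 m else if m = 0 then twistedGramCoeff χ a i 0
          else (twistedGramCoeff χ a i m + twistedGramCoeff χ a i (-(m : ℤ))) / 2) * x i) ^ 2 / d m
      ≤ x ⬝ᵥ (Matrix.of fun i i' : Fin B ↦
          (1 + θ) * (1 + η) * ((π / 4 + (∑ k ∈ weilPrimeIndex a, (Λ k : ℝ) / Real.sqrt k) + a * (1 + weilArchDensity (2 * a)) / (π * B₃)) ^ 2 / (π ^ 2 * d₀))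
            * (∑ j : Fin J, ∑ j' : Fin J, (((1 / (((2 * (j : ℕ) + 1) + (2 * (j' : ℕ) + 1) - 1 : ℕ) * (((B₃ - 1 : ℕ) : ℝ)) ^ ((2 * (j : ℕ) + 1) + (2 * (j' : ℕ) + 1) - 1)) + 1 / (((2 * (j : ℕ) + 1) + (2 * (j' : ℕ) + 1) - 1 : ℕ) * (B₃ : ℝ) ^ ((2 * (j : ℕ) + 1) + (2 * (j' : ℕ) + 1) - 1))) / 2) + (if j = j' then (∑ j' : Fin J, ((1 / (((2 * (j : ℕ) + 1) + (2 * (j' : ℕ) + 1) - 1 : ℕ) * (((B₃ - 1 : ℕ) : ℝ)) ^ ((2 * (j : ℕ) + 1) + (2 * (j' : ℕ) + 1) - 1)) - 1 / (((2 * (j : ℕ) + 1) + (2 * (j' : ℕ) + 1) - 1 : ℕ) * (B₃ : ℝ) ^ ((2 * (j : ℕ) + 1) + (2 * (j' : ℕ) + 1) - 1))) / 2) * (B : ℝ) ^ (2 * (j' : ℕ) + 1) / (B : ℝ) ^ (2 * (j : ℕ) + 1)) else 0)) * ((-1 : ℝ) ^ (i : ℕ) * (i : ℝ) ^ (2 *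 (j : ℕ))) * ((-1 : ℝ) ^ (i' : ℕ) * (i' : ℝ) ^ (2 * (j' : ℕ))))
          + (1 + θ) * (1 + η⁻¹) * (1 / d₀)
            * (∑ r : Fin J, ∑ r' : Fin J, (((1 / (((2 * (r : ℕ) + 2) + (2 * (r' : ℕ) + 2) - 1 : ℕ) * (((B₃ - 1 : ℕ) : ℝ)) ^ ((2 * (r : ℕ) + 2) + (2 * (r' : ℕ) + 2) - 1)) + 1 / (((2 * (r : ℕ) + 2) + (2 * (r' : ℕ) + 2) - 1 : ℕ) * (B₃ : ℝ) ^ ((2 * (r : ℕ) + 2) + (2 * (r' : ℕ) + 2) - 1))) / 2) + (if r = r' then (∑ r' : Fin J, ((1 / (((2 * (r : ℕ) + 2) + (2 * (r' : ℕ) + 2) - 1 : ℕ) * (((B₃ - 1 : ℕ) : ℝ)) ^ ((2 * (r : ℕ) + 2) + (2 * (r' : ℕ) + 2) - 1)) - 1 / (((2 * (r : ℕ) + 2) + (2 * (r' : ℕ) + 2) - 1 : ℕ) * (B₃ : ℝ) ^ ((2 * (r : ℕ) + 2) + (2 * (r' : ℕ) + 2) - 1))) / 2) * (B : ℝ) ^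 (2 * (r' : ℕ) + 2) / (B : ℝ) ^ (2 * (r : ℕ) + 2)) else 0)) * ((-1 : ℝ) ^ (i : ℕ) * (-((i : ℝ) ^ (2 * (r : ℕ) + 1)) * ((Complex.digamma (1 / 4 + ((freq a i : ℝ) : ℂ) / 2 * I)).im / 2 + (∑ k ∈ weilPrimeIndex a, (χ (k : ZMod q)).re * ((Λ k : ℝ) / Real.sqrt k) * Real.sin (freq a i * Real.log k)) - archExpSumSin a i) / π)) * ((-1 : ℝ) ^ (i' : ℕ) * (-((i' : ℝ) ^ (2 * (r' : ℕ) + 1)) * ((Complex.digamma (1 / 4 + ((freq a i' : ℝ) : ℂ) / 2 * I)).im / 2 + (∑ k ∈ weilPrimeIndex a, (χ (k : ZMod q)).re * ((Λ k : ℝ) / Real.sqrt k) * Real.sin (freq a i' * Real.log k)) - archExpSumSin a i') / π)))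
          + (if i = i' then (1 + θ⁻¹) * ((B : ℝ) / (d₀ * ((4 * J + 1 : ℕ) * (((B₃ - 1 : ℕ) : ℝ)) ^ (4 * J + 1)))) * (2 * (π / 4 + (∑ k ∈ weilPrimeIndex a, (Λ k : ℝ) / Real.sqrt k) + a * (1 + weilArchDensity (2 * a)) / π) * (i : ℝ) ^ (2 * J) / π) ^ 2 else 0)) *ᵥ x := by
  refine (even_twisted_tailJ_majorant χ ha hB hBB hB₃ J d hd₀ hd hθ hη N x).trans (le_of_eq ?_)
  rw [dotProduct_mulVec_eq_sum_sum]
  simp only [Matrix.of_apply]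
  rw [sum_sum_mul_add3_eq, sum_sum_mul_gram_eq, sum_sum_mul_gram_eq, sum_sum_add_ite_mul_eq, sum_sum_add_ite_mul_eq]

/-- **Odd tail majorant for a character, order `J` — matrix form** (`hU₂` of
`sum_range_mul_mul_nonneg_of_certificate_sum_split`, odd sector). -/
theorem odd_twisted_tailJ_majorant_matrix (χ : DirichletCharacter ℂ q) (ha : 0 < a) {B B₃ : ℕ} (hB : 1 ≤ B) (hBB : 2 * B ≤ B₃) (J : ℕ)
    (d : ℕ → ℝ) {d₀ : ℝ} (hd₀ : 0 < d₀) (hd : ∀ l, B₃ ≤ l → d₀ ≤ d l) {θ η : ℝ} (hθ : 0 < θ) (hη : 0 < η)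
    (N : ℕ) (x : Fin B → ℝ) :
    ∑ l ∈ Finset.Ico B₃ N, (∑ k : Fin B,
        ((twistedGramCoeff χ a (((k : ℕ) : ℤ) + 1) ((l : ℤ) + 1) - twistedGramCoeff χ a (((k : ℕ) : ℤ) + 1) (-((l : ℤ) + 1))) / 2) * x k) ^ 2 / d l
      ≤ x ⬝ᵥ (Matrix.of fun k k' : Fin B ↦
          (1 + θ) * (1 + η) * ((π / 4 + (∑ k ∈ weilPrimeIndex a, (Λ k : ℝ) / Real.sqrt k) + a * (1 + weilArchDensity (2 * a)) / (π * ((B₃ : ℝ) + 1))) ^ 2 / (π ^ 2 * d₀))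
            * (∑ j : Fin J, ∑ j' : Fin J, (((1 / (((2 * (j : ℕ) + 2) + (2 * (j' : ℕ) + 2) - 1 : ℕ) * (B₃ : ℝ) ^ ((2 * (j : ℕ) + 2) + (2 * (j' : ℕ) + 2) - 1)) + 1 / (((2 * (j : ℕ) + 2) + (2 * (j' : ℕ) + 2) - 1 : ℕ) * ((B₃ + 1 : ℕ) : ℝ) ^ ((2 * (j : ℕ) + 2) + (2 * (j' : ℕ) + 2) - 1))) / 2) + (if j = j' then (∑ j' : Fin J, ((1 / (((2 * (j : ℕ) + 2) + (2 * (j' : ℕ) + 2) - 1 : ℕ) * (B₃ : ℝ) ^ ((2 * (j : ℕ) + 2) + (2 * (j' : ℕ) + 2) - 1)) - 1 / (((2 * (j : ℕ) + 2) + (2 * (j' : ℕ) + 2) - 1 : ℕ) * ((B₃ + 1 : ℕ) : ℝ) ^ ((2 * (j : ℕ) + 2) + (2 * (j' : ℕ) + 2) - 1))) / 2) * (B : ℝ) ^ (2 * (j' : ℕ) + 2) / (B : ℝ) ^ (2 * (j : ℕ) + 2)) else 0)) * ((-1 : ℝ) ^ ((k : ℕ) + 1) * (((k : ℕ) : ℝ)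 + 1) ^ (2 * (j : ℕ) + 1)) * ((-1 : ℝ) ^ ((k' : ℕ) + 1) * (((k' : ℕ) : ℝ) + 1) ^ (2 * (j' : ℕ) + 1)))
          + (1 + θ) * (1 + η⁻¹) * (1 / d₀)
            * (∑ r : Fin J, ∑ r' : Fin J, (((1 / (((2 * (r : ℕ) + 1) + (2 * (r' : ℕ) + 1) - 1 : ℕ) * (B₃ : ℝ) ^ ((2 * (r : ℕ) + 1) + (2 * (r' : ℕ) + 1) - 1)) + 1 / (((2 * (r : ℕ) + 1) + (2 * (r' : ℕ) + 1) - 1 : ℕ) * ((B₃ + 1 : ℕ) : ℝ) ^ ((2 * (r : ℕ) + 1) + (2 * (r' : ℕ) + 1) - 1))) / 2) + (if r = r' then (∑ r' : Fin J, ((1 / (((2 * (r : ℕ) + 1) + (2 * (r' : ℕ) + 1) - 1 : ℕ) * (B₃ : ℝ) ^ ((2 * (r : ℕ) + 1) + (2 * (r' : ℕ) + 1) - 1)) - 1 / (((2 * (r : ℕ) + 1) + (2 * (r' : ℕ) + 1) - 1 : ℕ) * ((B₃ + 1 : ℕ) : ℝ) ^ ((2 * (r : ℕ) + 1) + (2 *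 (r' : ℕ) + 1) - 1))) / 2) * (B : ℝ) ^ (2 * (r' : ℕ) + 1) / (B : ℝ) ^ (2 * (r : ℕ) + 1)) else 0)) * ((-1 : ℝ) ^ ((k : ℕ) + 1) * (-((((k : ℕ) : ℝ) + 1) ^ (2 * (r : ℕ))) * ((Complex.digamma (1 / 4 + ((freq a (((k : ℕ) : ℤ) + 1) : ℝ) : ℂ) / 2 * I)).im / 2 + (∑ p ∈ weilPrimeIndex a, (χ (p : ZMod q)).re * ((Λ p : ℝ) / Real.sqrt p) * Real.sin (freq a (((k : ℕ) : ℤ) + 1) * Real.log p)) - archExpSumSin a (((k : ℕ) : ℤ) + 1)) / π)) * ((-1 : ℝ) ^ ((k' : ℕ) + 1) * (-((((k' : ℕ) : ℝ) + 1) ^ (2 * (r' : ℕ))) * ((Complex.digamma (1 / 4 + ((freq a (((k' : ℕ) : ℤ) + 1) : ℝ) : ℂ) / 2 * I)).im / 2 + (∑ p ∈ weilPrimeIndex a, (χ (p : ZMod q)).re * ((Λ p : ℝ) / Real.sqrt p) * Real.sin (freq a (((k' : ℕ) : ℤ) + 1) * Real.log p)) - archExpSumSin a (((k' : ℕ) :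 ℤ) + 1)) / π)))
          + (if k = k' then (1 + θ⁻¹) * ((B : ℝ) / (d₀ * ((4 * J + 1 : ℕ) * (B₃ : ℝ) ^ (4 * J + 1)))) * (2 * (π / 4 + (∑ k ∈ weilPrimeIndex a, (Λ k : ℝ) / Real.sqrt k) + a * (1 + weilArchDensity (2 * a)) / π) * (((k : ℕ) : ℝ) + 1) ^ (2 * J) / π) ^ 2 else 0)) *ᵥ x := by
  refine (odd_twisted_tailJ_majorant χ ha hB hBB J d hd₀ hd hθ hη N x).trans (le_of_eq ?_)
  rw [dotProduct_mulVec_eq_sum_sum]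
  simp only [Matrix.of_apply]
  rw [sum_sum_mul_add3_eq, sum_sum_mul_gram_eq, sum_sum_mul_gram_eq, sum_sum_add_ite_mul_eq, sum_sum_add_ite_mul_eq]

end MatrixForm

/-! ## The data-only rung theorem at order `J` -/

section Rung

/-- **Twisted format C, data-only front door at tail order `J`** (real χ of either parity).  See the module docstring:
every hypothesis is a finite numeric inequality or a kernel PSD statement about explicit real matrices built from
`twistedGramCoeff χ a`; the conclusion is the rung `WeilPositivityOnChar χ a`. -/
theorem weilPositivityOnChar_of_twisted_formatC_dataJ (hq : q ≠ 1) (χ : DirichletCharacter ℂ q)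
    (hχ : ∀ n : ℕ, conj (χ (n : ZMod q)) = χ (n : ZMod q)) (ha : 0 < a)
    -- EVEN sector data
    {Be B3e : ℕ} (hBe : 2 ≤ Be) (hBBe : 2 * Be ≤ B3e) (Je : ℕ) {θe ηe d0e : ℝ} (hθe : 0 < θe) (hηe : 0 < ηe)
    (we : ℕ → ℝ)
    (h0e : 0 < ((reDigammaQuarter (freq a Be) - Real.log π + Real.log q) / 2 - a * (1 + weilArchDensity (2 * a)) / (π ^ 2 * Be ^ 2) - 1 / (8 * Be) - a * (1 + weilArchDensity (2 * a)) / π ^ 2 * Real.sqrt (8 / ((Be - 1 : ℕ) : ℝ)) - (∑ k ∈ weilPrimeIndex a, (Λ k : ℝ) / Real.sqrt k * (2 * Real.cos (π / (⌊2 * a / Real.log k⌋₊ + 2)))) / 2))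
    (hd0e : 0 < d0e ∧ d0e ≤ ((reDigammaQuarter (freq a B3e) - Real.log π + Real.log q) / 2 - a * (1 + weilArchDensity (2 * a)) / (π ^ 2 * B3e ^ 2) - 1 / (8 * B3e) - a * (1 + weilArchDensity (2 * a)) / π ^ 2 * Real.sqrt (8 / ((Be - 1 : ℕ) : ℝ)) - (∑ k ∈ weilPrimeIndex a, (Λ k : ℝ) / Real.sqrt k * (2 * Real.cos (π / (⌊2 * a / Real.log k⌋₊ + 2)))) / 2))
    (hwe : ∀ m, Be ≤ m → m < B3e → 0 < we m ∧ we m ≤ ((reDigammaQuarter (freq a m) - Real.log π + Real.log q) / 2 - a * (1 + weilArchDensity (2 * a)) / (π ^ 2 * m ^ 2) - 1 / (8 * m) - a * (1 + weilArchDensity (2 * a)) / π ^ 2 * Real.sqrt (8 / ((Be - 1 : ℕ) : ℝ)) - (∑ k ∈ weilPrimeIndex a, (Λ k : ℝ) / Real.sqrt k * (2 * Real.cos (π / (⌊2 * a / Real.log k⌋₊ + 2)))) / 2))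
    (hSe : ∀ x : Fin Be → ℝ, 0 ≤ ∑ i, ∑ i', x i * x i' *
      ((if (i : ℕ) = 0 then twistedGramCoeff χ a 0 i' else if (i' : ℕ) = 0 then twistedGramCoeff χ a i 0 else (twistedGramCoeff χ a i i' + twistedGramCoeff χ a i (-(i' : ℤ))) / 2)
        - (∑ m ∈ Finset.Ico Be B3e, (if (i : ℕ) = 0 then twistedGramCoeff χ a 0 m else if m = 0 then twistedGramCoeff χ a i 0 else (twistedGramCoeff χ a i m + twistedGramCoeff χ a i (-(m : ℤ))) / 2) * (if (i' : ℕ) = 0 then twistedGramCoeff χ a 0 m else if m = 0 then twistedGramCoeff χ a i' 0 else (twistedGramCoeff χ a i' m + twistedGramCoeff χ a i' (-(m : ℤ))) / 2) / we m)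
        - ((1 + θe) * (1 + ηe) * ((π / 4 + (∑ k ∈ weilPrimeIndex a, (Λ k : ℝ) / Real.sqrt k) + a * (1 + weilArchDensity (2 * a)) / (π * B3e)) ^ 2 / (π ^ 2 * d0e))
            * (∑ j : Fin Je, ∑ j' : Fin Je, (((1 / (((2 * (j : ℕ) + 1) + (2 * (j' : ℕ) + 1) - 1 : ℕ) * (((B3e - 1 : ℕ) : ℝ)) ^ ((2 * (j : ℕ) + 1) + (2 * (j' : ℕ) + 1) - 1)) + 1 / (((2 * (j : ℕ) + 1) + (2 * (j' : ℕ) + 1) - 1 : ℕ) * (B3e : ℝ) ^ ((2 * (j : ℕ) + 1) + (2 * (j' : ℕ) + 1) - 1))) / 2) + (if j = j' then (∑ j' : Fin Je, ((1 / (((2 * (j : ℕ) + 1) + (2 * (j' : ℕ) + 1) - 1 : ℕ) * (((B3e - 1 : ℕ) : ℝ)) ^ ((2 * (j : ℕ) + 1) + (2 * (j' : ℕ) + 1) - 1)) - 1 / (((2 * (j : ℕ) + 1) + (2 * (j' : ℕ) + 1) - 1 : ℕ) * (B3e : ℝ) ^ ((2 * (j : ℕ) + 1) + (2 * (j' : ℕ)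 + 1) - 1))) / 2) * (Be : ℝ) ^ (2 * (j' : ℕ) + 1) / (Be : ℝ) ^ (2 * (j : ℕ) + 1)) else 0)) * ((-1 : ℝ) ^ (i : ℕ) * (i : ℝ) ^ (2 * (j : ℕ))) * ((-1 : ℝ) ^ (i' : ℕ) * (i' : ℝ) ^ (2 * (j' : ℕ))))
          + (1 + θe) * (1 + ηe⁻¹) * (1 / d0e)
            * (∑ r : Fin Je, ∑ r' : Fin Je, (((1 / (((2 * (r : ℕ) + 2) + (2 * (r' : ℕ) + 2) - 1 : ℕ) * (((B3e - 1 : ℕ) : ℝ)) ^ ((2 * (r : ℕ) + 2) + (2 * (r' : ℕ) + 2) - 1)) + 1 / (((2 * (r : ℕ) + 2) + (2 * (r' : ℕ) + 2) - 1 : ℕ) * (B3e : ℝ) ^ ((2 * (r : ℕ) + 2) + (2 * (r' : ℕ) + 2) - 1))) / 2) + (if r = r' then (∑ r' : Fin Je, ((1 / (((2 * (r : ℕ) + 2) + (2 * (r' : ℕ) + 2) - 1 : ℕ) * (((B3e - 1 : ℕ) : ℝ)) ^ ((2 * (r : ℕ) + 2) + (2 * (r' : ℕ) + 2) - 1)) -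 1 / (((2 * (r : ℕ) + 2) + (2 * (r' : ℕ) + 2) - 1 : ℕ) * (B3e : ℝ) ^ ((2 * (r : ℕ) + 2) + (2 * (r' : ℕ) + 2) - 1))) / 2) * (Be : ℝ) ^ (2 * (r' : ℕ) + 2) / (Be : ℝ) ^ (2 * (r : ℕ) + 2)) else 0)) * ((-1 : ℝ) ^ (i : ℕ) * (-((i : ℝ) ^ (2 * (r : ℕ) + 1)) * ((Complex.digamma (1 / 4 + ((freq a i : ℝ) : ℂ) / 2 * I)).im / 2 + (∑ k ∈ weilPrimeIndex a, (χ (k : ZMod q)).re * ((Λ k : ℝ) / Real.sqrt k) * Real.sin (freq a i * Real.log k)) - archExpSumSin a i) / π)) * ((-1 : ℝ) ^ (i' : ℕ) * (-((i' : ℝ) ^ (2 * (r' : ℕ) + 1)) * ((Complex.digamma (1 / 4 + ((freq a i' : ℝ) : ℂ) / 2 * I)).im / 2 + (∑ k ∈ weilPrimeIndex a, (χ (k : ZMod q)).re * ((Λ k : ℝ) / Real.sqrt k) * Real.sin (freq a i' * Real.log k)) - archExpSumSin a i') / π)))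
          + (if i = i' then (1 + θe⁻¹) * ((Be : ℝ) / (d0e * ((4 * Je + 1 : ℕ) * (((B3e - 1 : ℕ) : ℝ)) ^ (4 * Je + 1)))) * (2 * (π / 4 + (∑ k ∈ weilPrimeIndex a, (Λ k : ℝ) / Real.sqrt k) + a * (1 + weilArchDensity (2 * a)) / π) * (i : ℝ) ^ (2 * Je) / π) ^ 2 else 0))))
    -- ODD sector data
    {Bo B3o : ℕ} (hBo : 1 ≤ Bo) (hBBo : 2 * Bo ≤ B3o) (Jo : ℕ) {θo ηo d0o : ℝ} (hθo : 0 < θo) (hηo : 0 < ηo)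
    (wo : ℕ → ℝ)
    (h0o : 0 < ((reDigammaQuarter (freq a ((Bo : ℤ) + 1)) - Real.log π + Real.log q) / 2 - 1 / (8 * ((Bo : ℝ) + 1)) - a * (1 + weilArchDensity (2 * a)) / (π ^ 2 * ((Bo : ℝ) + 1) ^ 2)) - π / 4 - a * (1 + weilArchDensity (2 * a)) / π ^ 2 * Real.sqrt (8 / Bo) - (∑ k ∈ weilPrimeIndex a, (Λ k : ℝ) / Real.sqrt k * (2 * Real.cos (π / (⌊2 * a / Real.log k⌋₊ + 2)))) / 2)
    (hd0o : 0 < d0o ∧ d0o ≤ ((reDigammaQuarter (freq a ((B3o : ℤ) + 1)) - Real.log π + Real.log q) / 2 - 1 / (8 * ((B3o : ℝ) + 1)) - a * (1 + weilArchDensity (2 * a)) / (π ^ 2 * ((B3o : ℝ) + 1) ^ 2)) - π / 4 - a * (1 + weilArchDensity (2 * a)) / π ^ 2 * Real.sqrt (8 / Bo) - (∑ k ∈ weilPrimeIndex a, (Λ k : ℝ) / Real.sqrt k * (2 * Real.cos (π / (⌊2 * a / Real.log k⌋₊ + 2)))) / 2)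
    (hwo : ∀ l, Bo ≤ l → l < B3o → 0 < wo l ∧ wo l ≤ ((reDigammaQuarter (freq a ((l : ℤ) + 1)) - Real.log π + Real.log q) / 2 - 1 / (8 * ((l : ℝ) + 1)) - a * (1 + weilArchDensity (2 * a)) / (π ^ 2 * ((l : ℝ) + 1) ^ 2) - (π / 2 - Real.arctan (Real.sqrt Bo / Real.sqrt ((l : ℝ) + 1))) / 2 - a * (1 + weilArchDensity (2 * a)) / π ^ 2 * Real.sqrt (8 / Bo) - (∑ k ∈ weilPrimeIndex a, (Λ k : ℝ) / Real.sqrt k * (2 * Real.cos (π / (⌊2 * a / Real.log k⌋₊ + 2)))) / 2))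
    (hSo : ∀ x : Fin Bo → ℝ, 0 ≤ ∑ k, ∑ k', x k * x k' *
      (((twistedGramCoeff χ a (((k : ℕ) : ℤ) + 1) (((k' : ℕ) : ℤ) + 1) - twistedGramCoeff χ a (((k : ℕ) : ℤ) + 1) (-(((k' : ℕ) : ℤ) + 1))) / 2)
        - (∑ l ∈ Finset.Ico Bo B3o, ((twistedGramCoeff χ a (((k : ℕ) : ℤ) + 1) ((l : ℤ) + 1) - twistedGramCoeff χ a (((k : ℕ) : ℤ) + 1) (-((l : ℤ) + 1))) / 2) * ((twistedGramCoeff χ a (((k' : ℕ) : ℤ) + 1) ((l : ℤ) + 1) - twistedGramCoeff χ a (((k' : ℕ) : ℤ) + 1) (-((l : ℤ) + 1))) / 2) / wo l)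
        - ((1 + θo) * (1 + ηo) * ((π / 4 + (∑ k ∈ weilPrimeIndex a, (Λ k : ℝ) / Real.sqrt k) + a * (1 + weilArchDensity (2 * a)) / (π * ((B3o : ℝ) + 1))) ^ 2 / (π ^ 2 * d0o))
            * (∑ j : Fin Jo, ∑ j' : Fin Jo, (((1 / (((2 * (j : ℕ) + 2) + (2 * (j' : ℕ) + 2) - 1 : ℕ) * (B3o : ℝ) ^ ((2 * (j : ℕ) + 2) + (2 * (j' : ℕ) + 2) - 1)) + 1 / (((2 * (j : ℕ) + 2) + (2 * (j' : ℕ) + 2) - 1 : ℕ) * ((B3o + 1 : ℕ) : ℝ) ^ ((2 * (j : ℕ) + 2) + (2 * (j' : ℕ) + 2) - 1))) / 2) + (if j = j' then (∑ j' : Fin Jo, ((1 / (((2 * (j : ℕ) + 2) + (2 * (j' : ℕ) + 2) - 1 : ℕ) * (B3o : ℝ) ^ ((2 * (j : ℕ) + 2) + (2 * (j' : ℕ) + 2) - 1)) - 1 / (((2 * (j : ℕ) + 2) + (2 * (j' : ℕ) + 2) - 1 : ℕ) * ((B3o + 1 : ℕ) : ℝ) ^ ((2 * (j : ℕ) + 2)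 + (2 * (j' : ℕ) + 2) - 1))) / 2) * (Bo : ℝ) ^ (2 * (j' : ℕ) + 2) / (Bo : ℝ) ^ (2 * (j : ℕ) + 2)) else 0)) * ((-1 : ℝ) ^ ((k : ℕ) + 1) * (((k : ℕ) : ℝ) + 1) ^ (2 * (j : ℕ) + 1)) * ((-1 : ℝ) ^ ((k' : ℕ) + 1) * (((k' : ℕ) : ℝ) + 1) ^ (2 * (j' : ℕ) + 1)))
          + (1 + θo) * (1 + ηo⁻¹) * (1 / d0o)
            * (∑ r : Fin Jo, ∑ r' : Fin Jo, (((1 / (((2 * (r : ℕ) + 1) + (2 * (r' : ℕ) + 1) - 1 : ℕ) * (B3o : ℝ) ^ ((2 * (r : ℕ) + 1) + (2 * (r' : ℕ) + 1) - 1)) + 1 / (((2 * (r : ℕ) + 1) + (2 * (r' : ℕ) + 1) - 1 : ℕ) * ((B3o + 1 : ℕ) : ℝ) ^ ((2 * (r : ℕ) + 1) + (2 * (r' : ℕ) + 1) - 1))) / 2) + (if r = r' then (∑ r' : Fin Jo, ((1 / (((2 * (r : ℕ) + 1) + (2 * (r' : ℕ) + 1) - 1 : ℕ) * (B3o : ℝ)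 ^ ((2 * (r : ℕ) + 1) + (2 * (r' : ℕ) + 1) - 1)) - 1 / (((2 * (r : ℕ) + 1) + (2 * (r' : ℕ) + 1) - 1 : ℕ) * ((B3o + 1 : ℕ) : ℝ) ^ ((2 * (r : ℕ) + 1) + (2 * (r' : ℕ) + 1) - 1))) / 2) * (Bo : ℝ) ^ (2 * (r' : ℕ) + 1) / (Bo : ℝ) ^ (2 * (r : ℕ) + 1)) else 0)) * ((-1 : ℝ) ^ ((k : ℕ) + 1) * (-((((k : ℕ) : ℝ) + 1) ^ (2 * (r : ℕ))) * ((Complex.digamma (1 / 4 + ((freq a (((k : ℕ) : ℤ) + 1) : ℝ) : ℂ) / 2 * I)).im / 2 + (∑ p ∈ weilPrimeIndex a, (χ (p : ZMod q)).re * ((Λ p : ℝ) / Real.sqrt p) * Real.sin (freq a (((k : ℕ) : ℤ) + 1) * Real.log p)) - archExpSumSin a (((k : ℕ) : ℤ) + 1)) / π)) * ((-1 : ℝ) ^ ((k' : ℕ) + 1) * (-((((k' : ℕ) : ℝ) + 1) ^ (2 * (r' : ℕ))) * ((Complex.digamma (1 / 4 + ((freq a (((k' : ℕ) : ℤ) +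 1) : ℝ) : ℂ) / 2 * I)).im / 2 + (∑ p ∈ weilPrimeIndex a, (χ (p : ZMod q)).re * ((Λ p : ℝ) / Real.sqrt p) * Real.sin (freq a (((k' : ℕ) : ℤ) + 1) * Real.log p)) - archExpSumSin a (((k' : ℕ) : ℤ) + 1)) / π)))
          + (if k = k' then (1 + θo⁻¹) * ((Bo : ℝ) / (d0o * ((4 * Jo + 1 : ℕ) * (B3o : ℝ) ^ (4 * Jo + 1)))) * (2 * (π / 4 + (∑ k ∈ weilPrimeIndex a, (Λ k : ℝ) / Real.sqrt k) + a * (1 + weilArchDensity (2 * a)) / π) * (((k : ℕ) : ℝ) + 1) ^ (2 * Jo) / π) ^ 2 else 0)))) :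
    WeilPositivityOnChar χ a := by
  have hE0 : 0 < weilArchDensity (2 * a) := weilArchDensity_pos (by positivity)
  have hC : 0 ≤ a * (1 + weilArchDensity (2 * a)) := by positivity
  -- the sector kernels and far diagonals as functions
  set Mev : ℕ → ℕ → ℝ := fun i j ↦ (if i = 0 then twistedGramCoeff χ a 0 j else if j = 0 then twistedGramCoeff χ a i 0 else (twistedGramCoeff χ a i j + twistedGramCoeff χ a i (-(j : ℤ))) / 2) with hMev
  set Mod : ℕ → ℕ → ℝ := fun k l ↦ ((twistedGramCoeff χ a ((k : ℤ) + 1) ((l : ℤ) + 1) - twistedGramCoeff χ a ((k : ℤ) + 1) (-((l : ℤ) + 1))) / 2) with hMod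
  set dev : ℕ → ℝ := fun m ↦ ((reDigammaQuarter (freq a m) - Real.log π + Real.log q) / 2 - a * (1 + weilArchDensity (2 * a)) / (π ^ 2 * m ^ 2) - 1 / (8 * m) - a * (1 + weilArchDensity (2 * a)) / π ^ 2 * Real.sqrt (8 / ((Be - 1 : ℕ) : ℝ)) - (∑ k ∈ weilPrimeIndex a, (Λ k : ℝ) / Real.sqrt k * (2 * Real.cos (π / (⌊2 * a / Real.log k⌋₊ + 2)))) / 2) with hdev
  set dod : ℕ → ℝ := fun l ↦ ((reDigammaQuarter (freq a ((l : ℤ) + 1)) - Real.log π + Real.log q) / 2 - 1 / (8 * ((l : ℝ) + 1)) - a * (1 + weilArchDensity (2 * a)) / (π ^ 2 * ((l : ℝ) + 1) ^ 2) - (π / 2 - Real.arctan (Real.sqrt Bo / Real.sqrt ((l : ℝ) + 1))) / 2 - a * (1 + weilArchDensity (2 * a)) / π ^ 2 * Real.sqrt (8 / Bo) - (∑ k ∈ weilPrimeIndex a, (Λ k : ℝ) / Real.sqrt k * (2 * Real.cos (π / (⌊2 * a / Real.log k⌋₊ + 2)))) / 2) with hdod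
  have hsymm := twistedGramCoeff_comm χ a
  have hrefl := twistedGramCoeff_neg_neg χ a
  refine weilPositivityOnChar_of_twistedGramCoeff_sector_psd_real hq χ hχ ha ?_ ?_
  · -- EVEN sector
    intro K y
    have hB3e : 2 ≤ B3e := by omega
    have hB3e1 : 1 ≤ B3e := by omega
    have hBe1 : 1 ≤ Be := by omega
    have hd : ∀ m, Be ≤ m → 0 < dev m := fun m hm ↦ by
      simp only [hdev]
      have h := even_dhat_core_mono ha hC hBe1 hm
      linarith
    have hdmono : ∀ m, B3e ≤ m → d0e ≤ dev m := fun m hm ↦ by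
      simp only [hdev]
      have h := even_dhat_core_mono ha hC hB3e1 hm
      linarith [hd0e.2]
    have hfar : ∀ (N : ℕ) (y : ℕ → ℝ),
        ∑ n ∈ Finset.Ico Be N, dev n * y n ^ 2 ≤ ∑ n ∈ Finset.Ico Be N, ∑ m ∈ Finset.Ico Be N, y n * Mev n m * y m :=
      fun N y ↦ by
        simp only [hdev, hMev]
        exact twistedGramCoeff_even_far_ge_diag χ ha hBe N y
    have hU1 : ∀ x : Fin Be → ℝ,
        ∑ m ∈ Finset.Ico Be B3e, (∑ i : Fin Be, Mev i m * x i) ^ 2 / dev m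
          ≤ x ⬝ᵥ (Matrix.of fun i j : Fin Be ↦ ∑ m ∈ Finset.Ico Be B3e, Mev i m * Mev j m / we m) *ᵥ x :=
      fun x ↦ columns_majorant (Finset.Ico Be B3e) (fun m i ↦ Mev i m) dev we
        (fun m hm ↦ by
          have hm := Finset.mem_Ico.mp hm
          have h := hwe m hm.1 hm.2
          simp only [hdev]
          exact h) x
    have hU2 := fun (N : ℕ) (x : Fin Be → ℝ) ↦
      even_twisted_tailJ_majorant_matrix χ ha hBe1 hBBe hB3e Je dev hd0e.1 hdmono hθe hηe N x
    have key := sum_range_mul_mul_nonneg_of_certificate_sum_split Mev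
      (fun n m ↦ evenKernel_symm (twistedGramCoeff χ a) hsymm hrefl n m)
      Be B3e (by omega) dev _ _ hd hfar hU1 (fun N x ↦ by
        have h := hU2 N x
        simp only [hMev, hdev] at h ⊢
        exact h) (fun x ↦ by
        have h := hSe x
        simp only [hMev, Matrix.of_apply] at h ⊢
        exact h) (K + 1) y
    simpa only [hMev] using key
  · -- ODD sector
    intro K z
    have hB3o : 1 ≤ B3o := by omega
    have hd : ∀ l, Bo ≤ l → 0 < dod l := fun l hl ↦ by
      simp only [hdod]
      have h := odd_dhat_core_mono ha hC hl
      have hpen := hilbert_atan_penalty_le Bo l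
      linarith
    have hdlow : ∀ l, B3o ≤ l → d0o ≤ dod l := fun l hl ↦ by
      simp only [hdod]
      have h := odd_dhat_core_mono ha hC hl
      have hpen := hilbert_atan_penalty_le Bo l
      linarith [hd0o.2]
    have hfar : ∀ (N : ℕ) (z : ℕ → ℝ),
        ∑ k ∈ Finset.Ico Bo N, dod k * z k ^ 2 ≤ ∑ k ∈ Finset.Ico Bo N, ∑ l ∈ Finset.Ico Bo N, z k * Mod k l * z l :=
      fun N z ↦ by
        simp only [hdod, hMod]
        exact twistedGramCoeff_odd_far_ge_diag_atan χ ha hBo N z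
    have hU1 : ∀ x : Fin Bo → ℝ,
        ∑ l ∈ Finset.Ico Bo B3o, (∑ k : Fin Bo, Mod k l * x k) ^ 2 / dod l
          ≤ x ⬝ᵥ (Matrix.of fun k k' : Fin Bo ↦ ∑ l ∈ Finset.Ico Bo B3o, Mod k l * Mod k' l / wo l) *ᵥ x :=
      fun x ↦ columns_majorant (Finset.Ico Bo B3o) (fun l k ↦ Mod k l) dod wo
        (fun l hl ↦ by
          have hl := Finset.mem_Ico.mp hl
          have h := hwo l hl.1 hl.2
          simp only [hdod]
          exact h) x
    have hU2 := fun (N : ℕ) (x : Fin Bo → ℝ) ↦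
      odd_twisted_tailJ_majorant_matrix χ ha hBo hBBo Jo dod hd0o.1 hdlow hθo hηo N x
    have key := sum_range_mul_mul_nonneg_of_certificate_sum_split Mod
      (fun k l ↦ oddKernel_symm (twistedGramCoeff χ a) hsymm hrefl k l)
      Bo B3o (by omega) dod _ _ hd hfar hU1 (fun N x ↦ by
        have h := hU2 N x
        simp only [hMod, hdod] at h ⊢
        exact h) (fun x ↦ by
        have h := hSo x
        simp only [hMod, Matrix.of_apply] at h ⊢
        exact h) K z
    simpa only [hMod] using key

end Rung

end Summit.Ventures.WeilGRH

end
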